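import Mathlib
import HarnessLib.Audit
import Summits.PneNP.PneNP.Theorems.PstarChordBridgeCornerUnit

/-!
# The (U2) corner with ONE forest witness (union port of `PstarChordBridgeCorner` / `PstarChordBridgeCornerUnit`; ROUND-24, memo §14.21–§14.24)

FRONTIER range-avoidance ladder, rung F-N3, ROUND 24 (cell `pnp-ideate`, planner memo `r24/CORE-BOUND-NOTES.md` §7 G4 / §9 O3 and §14.21 (single-chord world of Case B of
the union lemma); restricted-model proof complexity — nothing here bears on `P` versus `NP`).

`PstarChordBridgeCornerUnit.card_eq_three_of_corner` (the doubly-read single chord closes a triangle) assumes minimality (M0) at every path edge `j ∈ D e₀` but its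
proofs (`corner_not_const`, `corner_ne`, `corner_factorisation`, `corner_unit`) USE one arbitrary such witness.  The primed versions below take that ONE witness as a
hypothesis; everything else is verbatim.
-/

set_option linter.dupNamespace false -- `Summit.PneNP.PneNP.…`: summit = sub-problem name (D-0017 single-conjunct layout)

open Finset Module Literature.Computability.Complexity
open Summit.PneNP.PneNP.Theorems.PstarFibrePolys (bit)
open Summit.PneNP.PneNP.Theorems.PstarTyped (Typed)
open Summit.PneNP.PneNP.Theorems.PstarSALevel (varSet bdry BoundaryExpanding SimpleOverlap)
open Summit.PneNP.PneNP.Theorems.PstarGapOneAll (gval)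
open Summit.PneNP.PneNP.Theorems.PstarProductRank (qform polar)
open Summit.PneNP.PneNP.Theorems.PstarPathRank (AndAdj polar_basis andPair_ne)
open Summit.PneNP.PneNP.Theorems.PstarForcing (polar_unique exists_ne_of_rank_four)
open Summit.PneNP.PneNP.Theorems.PstarReadSumset (V2)
open Summit.PneNP.PneNP.Theorems.PstarChordSystem (ChordSystem)
open Summit.PneNP.PneNP.Theorems.PstarChordSystemMap (omega)
open Summit.PneNP.PneNP.Theorems.PstarChordBridgeTools
open Summit.PneNP.PneNP.Theorems.PstarChordBridge
open Summit.PneNP.PneNP.Theorems.PstarChordBridgeForcing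
open Summit.PneNP.PneNP.Theorems.PstarChordBridgeBasis
open Summit.PneNP.PneNP.Theorems.PstarChordBridgeForest (forest_minimality defect_eq_one)
open Summit.PneNP.PneNP.Theorems.PstarGapLinearised (andPair)
open Summit.PneNP.PneNP.Theorems.PstarCubeIdeals (IsAffineFn)
open Summit.PneNP.PneNP.Theorems.PstarForcing (forcing_cases exists_ne_of_rank_four)
open Summit.PneNP.PneNP.Theorems.PstarChordBridgeForcing (freeMon gam sys_u_eq qform_add' rank_four_of_wf const_of_unread)
open Summit.PneNP.PneNP.Theorems.PstarChordBridgeBasis (qDir polarDir)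
open Summit.PneNP.PneNP.Theorems.PstarChordBridgeCorner (qDir_add corner_factorisation)
open Summit.PneNP.PneNP.Theorems.PstarNorUnitDir (nor_unit_of_dir)
open Summit.PneNP.PneNP.Theorems.PstarNorUnitExc (exc_unit_of_dir)
open Summit.PneNP.PneNP.Theorems.PstarChordBridgeCorner
open Summit.PneNP.PneNP.Theorems.PstarChordBridgeCornerUnit

namespace Summit.PneNP.PneNP.Theorems.PstarUnionCornerWitness

variable {n m : ℕ}

/-- **In the (U2) corner no factor is constant** — one-witness form of `PstarChordBridgeCorner.corner_not_const`. -/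
theorem corner_not_const' (I : LocalMap 4 n m) (hI : I.IsPure xorAndPred) (hT : Typed I) (hS : SimpleOverlap I) {r₀ : ℕ}
    (hB : BoundaryExpanding r₀ I) {B : BridgeData n m} (hW : B.WF I) (hcard : B.J₀.card ≤ r₀) (hG₁ : Disjoint B.J₀ B.G₁) (hG₂ : Disjoint B.J₀ B.G₂)
    {e₀ : Fin m} (hN : B.N = {e₀}) {r r' : V2} (hr : r ≠ 0) (hr' : r' ≠ 0) (hne : r ≠ r')
    (hρ : ∀ x, (sys I B).ρ e₀ x = r) (hρ' : ∀ x, (sys I B).ρ' e₀ x = r')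
    (hG₁' : ∀ g ∈ B.G₁, I.vars g 2 ≠ I.vars e₀ 2 ∧ I.vars g 2 ≠ I.vars e₀ 3 ∧ I.vars g 3 ≠ I.vars e₀ 2 ∧ I.vars g 3 ≠ I.vars e₀ 3)
    (hG₂' : ∀ g ∈ B.G₂, I.vars g 2 ≠ I.vars e₀ 2 ∧ I.vars g 2 ≠ I.vars e₀ 3 ∧ I.vars g 3 ≠ I.vars e₀ 2 ∧ I.vars g 3 ≠ I.vars e₀ 3)
    (hinf : (sys I B).Infeasible B.N) (hT3 : ¬ ∃ z, Solution I B B.J₀ z) {j : Fin m} (hj : j ∈ B.D e₀) {z : Fin n → Bool} (hz : Solution I B (B.J₀.erase j) z)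
    {κ : ZMod 2} (hκ : ∀ x, qDir I B r x = κ) : False := by
  classical
  have he₀ : e₀ ∈ B.N := by rw [hN]; exact mem_singleton_self e₀
  have hinf' : (sys I B).Infeasible {e₀} := by rw [← hN]; exact hinf
  have hu := u_eq_prod_of_corner I B hr hr' hne hρ hρ' hinf'
  have hrank := rank_four_of_wf I hI hS hB hW hcard he₀
  -- `κ = 1`, else `u_{e₀}` would be constant
  have hκ1 : κ = 1 := by
    by_contra h0
    have hκ0 : κ = 0 := by revert h0; generalize κ = t; revert t; decide
    obtain ⟨v, hv⟩ := exists_ne_of_rank_four (qform_add' I (B.D e₀)) hrank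
    have h1 := hu v
    have h2 := hu 0
    rw [hκ, hκ0, mul_zero, zero_add, sys_u_eq] at h1 h2
    apply hv
    have key : ∀ g a b : ZMod 2, g + a = 1 → g + b = 1 → a = b := by decide
    exact key _ _ _ h1 h2
  subst hκ1
  -- so `q_{r'} = Q_{D e₀} + γ + 1`: polar forms agree, and `q_r ≡ 1` has polar form `0`
  have hu' : ∀ x, qDir I B r' x = gam B e₀ + qform (B.D e₀) (fun j => I.vars j 2) (fun j => I.vars j 3) x + 1 := fun x => by
    have h := hu x
    rw [hκ, mul_one, sys_u_eq] at h
    have key : ∀ s q : ZMod 2, s = q + 1 → q = s + 1 := by decide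
    exact key _ _ h
  have hpol' : polarDir I B r' = polar (B.D e₀) (fun j => I.vars j 2) (fun j => I.vars j 3) := by
    refine polar_unique (Q := qDir I B r') (qDir_add I B r') fun x w => ?_
    rw [hu', hu', hu', hu', qform_add' I (B.D e₀) x w]
    generalize gam B e₀ = g
    generalize qform (B.D e₀) (fun j => I.vars j 2) (fun j => I.vars j 3) x = a
    generalize qform (B.D e₀) (fun j => I.vars j 2) (fun j => I.vars j 3) w = b
    generalize qform (B.D e₀) (fun j => I.vars j 2) (fun j => I.vars j 3) (0 : Fin n → ZMod 2) = c
    generalize polar (B.D e₀) (fun j => I.vars j 2) (fun j => I.vars j 3) x w = d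
    revert g a b c d; decide
  have hpol : polarDir I B r = polar (∅ : Finset (Fin m)) (fun j => I.vars j 2) (fun j => I.vars j 3) := by
    rw [polar_empty]
    refine polar_unique (Q := qDir I B r) (qDir_add I B r) fun x w => ?_
    rw [hκ, hκ, hκ, hκ, LinearMap.zero_apply, LinearMap.zero_apply]; decide
  -- a path edge and its corner point
  have heD : e₀ ∉ B.D e₀ := fun h => (mem_sdiff.1 (hW.hD e₀ he₀ h)).2 he₀
  have hjJ : j ∈ B.J₀ := (mem_sdiff.1 (hW.hD e₀ he₀ hj)).1
  obtain ⟨hq', hq, hpq⟩ := corner_point I hI hT hW hN hj hr hr' hne hρ hρ' hG₁' hG₂' hT3 hz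
  rw [omega_tau_of_polar I hI hS B hG₁ hG₂ hpol' hjJ, if_pos hj] at hq'
  rw [omega_tau_of_polar I hI hS B hG₁ hG₂ hpol hjJ, if_neg (notMem_empty j), add_zero, hκ] at hq
  rw [hu, hκ, mul_one, hq'] at hpq
  rw [← hq] at hpq
  have key : ∀ p : ZMod 2, p * 1 = p + 1 + 1 + 1 → False := by decide
  exact key _ hpq

/-- **In the (U2) corner the two factors differ** — one-witness form of `PstarChordBridgeCorner.corner_ne`. -/
theorem corner_ne' (I : LocalMap 4 n m) (hI : I.IsPure xorAndPred) (hT : Typed I) (hS : SimpleOverlap I)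
    {B : BridgeData n m} (hW : B.WF I) (hG₁ : Disjoint B.J₀ B.G₁) (hG₂ : Disjoint B.J₀ B.G₂)
    {e₀ : Fin m} (hN : B.N = {e₀}) {r r' : V2} (hr : r ≠ 0) (hr' : r' ≠ 0) (hne : r ≠ r')
    (hρ : ∀ x, (sys I B).ρ e₀ x = r) (hρ' : ∀ x, (sys I B).ρ' e₀ x = r')
    (hG₁' : ∀ g ∈ B.G₁, I.vars g 2 ≠ I.vars e₀ 2 ∧ I.vars g 2 ≠ I.vars e₀ 3 ∧ I.vars g 3 ≠ I.vars e₀ 2 ∧ I.vars g 3 ≠ I.vars e₀ 3)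
    (hG₂' : ∀ g ∈ B.G₂, I.vars g 2 ≠ I.vars e₀ 2 ∧ I.vars g 2 ≠ I.vars e₀ 3 ∧ I.vars g 3 ≠ I.vars e₀ 2 ∧ I.vars g 3 ≠ I.vars e₀ 3)
    (hinf : (sys I B).Infeasible B.N) (hT3 : ¬ ∃ z, Solution I B B.J₀ z) {j : Fin m} (hj : j ∈ B.D e₀) {z : Fin n → Bool} (hz : Solution I B (B.J₀.erase j) z)
    (heq : ∀ x, qDir I B r x = qDir I B r' x) : False := by
  classical
  have he₀ : e₀ ∈ B.N := by rw [hN]; exact mem_singleton_self e₀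
  have hinf' : (sys I B).Infeasible {e₀} := by rw [← hN]; exact hinf
  have hu := u_eq_prod_of_corner I B hr hr' hne hρ hρ' hinf'
  -- `u = w·w + 1 = w + 1` with `w = q_r = q_{r'}`
  have hu' : ∀ x, qDir I B r' x = gam B e₀ + qform (B.D e₀) (fun j => I.vars j 2) (fun j => I.vars j 3) x + 1 := fun x => by
    have h := hu x
    rw [heq, sys_u_eq] at h
    have key : ∀ s q : ZMod 2, s = q * q + 1 → q = s + 1 := by decide
    exact key _ _ h
  have hpol' : polarDir I B r' = polar (B.D e₀) (fun j => I.vars j 2) (fun j => I.vars j 3) := by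
    refine polar_unique (Q := qDir I B r') (qDir_add I B r') fun x w => ?_
    rw [hu', hu', hu', hu', qform_add' I (B.D e₀) x w]
    generalize gam B e₀ = g
    generalize qform (B.D e₀) (fun j => I.vars j 2) (fun j => I.vars j 3) x = a
    generalize qform (B.D e₀) (fun j => I.vars j 2) (fun j => I.vars j 3) w = b
    generalize qform (B.D e₀) (fun j => I.vars j 2) (fun j => I.vars j 3) (0 : Fin n → ZMod 2) = c
    generalize polar (B.D e₀) (fun j => I.vars j 2) (fun j => I.vars j 3) x w = d
    revert g a b c d; decide
  have hpol : polarDir I B r = polar (B.D e₀) (fun j => I.vars j 2) (fun j => I.vars j 3) := by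
    refine polar_unique (Q := qDir I B r) (qDir_add I B r) fun x w => ?_
    rw [heq, heq, heq, heq, hu', hu', hu', hu', qform_add' I (B.D e₀) x w]
    generalize gam B e₀ = g
    generalize qform (B.D e₀) (fun j => I.vars j 2) (fun j => I.vars j 3) x = a
    generalize qform (B.D e₀) (fun j => I.vars j 2) (fun j => I.vars j 3) w = b
    generalize qform (B.D e₀) (fun j => I.vars j 2) (fun j => I.vars j 3) (0 : Fin n → ZMod 2) = c
    generalize polar (B.D e₀) (fun j => I.vars j 2) (fun j => I.vars j 3) x w = d
    revert g a b c d; decide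
  have heD : e₀ ∉ B.D e₀ := fun h => (mem_sdiff.1 (hW.hD e₀ he₀ h)).2 he₀
  have hjJ : j ∈ B.J₀ := (mem_sdiff.1 (hW.hD e₀ he₀ hj)).1
  obtain ⟨hq', hq, hpq⟩ := corner_point I hI hT hW hN hj hr hr' hne hρ hρ' hG₁' hG₂' hT3 hz
  rw [omega_tau_of_polar I hI hS B hG₁ hG₂ hpol' hjJ, if_pos hj] at hq'
  rw [omega_tau_of_polar I hI hS B hG₁ hG₂ hpol hjJ, if_pos hj] at hq
  -- `q_r = q_{r'}` at the corner point: `x_q + 1 = x_p + 1`; and `x_p x_q = q_{r'} q_r = (x_p + 1)(x_q + 1)`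
  have hpq' : bit (z (I.vars e₀ 2)) = bit (z (I.vars e₀ 3)) := by
    have h := heq (fun v => bit (z v))
    rw [hq, hq'] at h
    have key : ∀ p q : ZMod 2, q + 1 = p + 1 → p = q := by decide
    exact key _ _ h
  rw [hu, hq', hq, hpq'] at hpq
  have key : ∀ q : ZMod 2, q * q = (q + 1) * (q + 1) + 1 + 1 → False := by decide
  exact key _ hpq

/-- **The corner factorisation** — one-witness form of `PstarChordBridgeCorner.corner_factorisation`. -/
theorem corner_factorisation' (I : LocalMap 4 n m) (hI : I.IsPure xorAndPred) (hT : Typed I) (hS : SimpleOverlap I) {r₀ : ℕ}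
    (hB : BoundaryExpanding r₀ I) {B : BridgeData n m} (hW : B.WF I) (hcard : B.J₀.card ≤ r₀) (hG₁ : Disjoint B.J₀ B.G₁) (hG₂ : Disjoint B.J₀ B.G₂)
    {e₀ : Fin m} (hN : B.N = {e₀}) {r r' : V2} (hr : r ≠ 0) (hr' : r' ≠ 0) (hne : r ≠ r')
    (hρ : ∀ x, (sys I B).ρ e₀ x = r) (hρ' : ∀ x, (sys I B).ρ' e₀ x = r')
    (hG₁' : ∀ g ∈ B.G₁, I.vars g 2 ≠ I.vars e₀ 2 ∧ I.vars g 2 ≠ I.vars e₀ 3 ∧ I.vars g 3 ≠ I.vars e₀ 2 ∧ I.vars g 3 ≠ I.vars e₀ 3)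
    (hG₂' : ∀ g ∈ B.G₂, I.vars g 2 ≠ I.vars e₀ 2 ∧ I.vars g 2 ≠ I.vars e₀ 3 ∧ I.vars g 3 ≠ I.vars e₀ 2 ∧ I.vars g 3 ≠ I.vars e₀ 3)
    (hinf : (sys I B).Infeasible B.N) (hT3 : ¬ ∃ z, Solution I B B.J₀ z) {j : Fin m} (hj : j ∈ B.D e₀) {z : Fin n → Bool} (hz : Solution I B (B.J₀.erase j) z) :
    (∀ x, (sys I B).u e₀ x = qDir I B r' x * qDir I B r x + 1) ∧
    (¬ ∃ κ, ∀ x, qDir I B r x = κ) ∧ (¬ ∃ κ, ∀ x, qDir I B r' x = κ) ∧ ¬ (∀ x, qDir I B r x = qDir I B r' x) := by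
  have hinf' : (sys I B).Infeasible {e₀} := by rw [← hN]; exact hinf
  refine ⟨u_eq_prod_of_corner I B hr hr' hne hρ hρ' hinf', fun ⟨κ, hκ⟩ => ?_, fun ⟨κ, hκ⟩ => ?_, fun heq => ?_⟩
  · exact corner_not_const' I hI hT hS hB hW hcard hG₁ hG₂ hN hr hr' hne hρ hρ' hG₁' hG₂' hinf hT3 hj hz hκ
  · -- symmetric: swap the roles of the two privates by swapping `r ↔ r'`?  The factorisation is symmetric, but the corner point is not;
    -- we rerun the constant-factor argument with `q_{r'} ≡ κ`.
    classical
    have he₀ : e₀ ∈ B.N := by rw [hN]; exact mem_singleton_self e₀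
    have hu := u_eq_prod_of_corner I B hr hr' hne hρ hρ' hinf'
    have hrank := rank_four_of_wf I hI hS hB hW hcard he₀
    have hκ1 : κ = 1 := by
      by_contra h0
      have hκ0 : κ = 0 := by revert h0; generalize κ = t; revert t; decide
      obtain ⟨v, hv⟩ := exists_ne_of_rank_four (qform_add' I (B.D e₀)) hrank
      have h1 := hu v
      have h2 := hu 0
      rw [hκ, hκ0, zero_mul, zero_add, sys_u_eq] at h1 h2
      apply hv
      have key : ∀ g a b : ZMod 2, g + a = 1 → g + b = 1 → a = b := by decide
      exact key _ _ _ h1 h2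
    subst hκ1
    have hu' : ∀ x, qDir I B r x = gam B e₀ + qform (B.D e₀) (fun j => I.vars j 2) (fun j => I.vars j 3) x + 1 := fun x => by
      have h := hu x
      rw [hκ, one_mul, sys_u_eq] at h
      have key : ∀ s q : ZMod 2, s = q + 1 → q = s + 1 := by decide
      exact key _ _ h
    have hpol : polarDir I B r = polar (B.D e₀) (fun j => I.vars j 2) (fun j => I.vars j 3) := by
      refine polar_unique (Q := qDir I B r) (qDir_add I B r) fun x w => ?_
      rw [hu', hu', hu', hu', qform_add' I (B.D e₀) x w]
      generalize gam B e₀ = g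
      generalize qform (B.D e₀) (fun j => I.vars j 2) (fun j => I.vars j 3) x = a
      generalize qform (B.D e₀) (fun j => I.vars j 2) (fun j => I.vars j 3) w = b
      generalize qform (B.D e₀) (fun j => I.vars j 2) (fun j => I.vars j 3) (0 : Fin n → ZMod 2) = c
      generalize polar (B.D e₀) (fun j => I.vars j 2) (fun j => I.vars j 3) x w = d
      revert g a b c d; decide
    have hpol' : polarDir I B r' = polar (∅ : Finset (Fin m)) (fun j => I.vars j 2) (fun j => I.vars j 3) := by
      rw [polar_empty]
      refine polar_unique (Q := qDir I B r') (qDir_add I B r') fun x w => ?_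
      rw [hκ, hκ, hκ, hκ, LinearMap.zero_apply, LinearMap.zero_apply]; decide
    have heD : e₀ ∉ B.D e₀ := fun h => (mem_sdiff.1 (hW.hD e₀ he₀ h)).2 he₀
    have hjJ : j ∈ B.J₀ := (mem_sdiff.1 (hW.hD e₀ he₀ hj)).1
    obtain ⟨hq', hq, hpq⟩ := corner_point I hI hT hW hN hj hr hr' hne hρ hρ' hG₁' hG₂' hT3 hz
    rw [omega_tau_of_polar I hI hS B hG₁ hG₂ hpol' hjJ, if_neg (notMem_empty j), add_zero, hκ] at hq'
    rw [omega_tau_of_polar I hI hS B hG₁ hG₂ hpol hjJ, if_pos hj] at hq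
    rw [hu, hκ, one_mul, hq] at hpq
    rw [← hq'] at hpq
    have key : ∀ q : ZMod 2, 1 * q = q + 1 + 1 + 1 → False := by decide
    exact key _ hpq
  · exact corner_ne' I hI hT hS hW hG₁ hG₂ hN hr hr' hne hρ hρ' hG₁' hG₂' hinf hT3 hj hz heq

/-- **The (U2) corner is a CONS-T unit** — one-witness form of `PstarChordBridgeCornerUnit.corner_unit`. -/
theorem corner_unit' (I : LocalMap 4 n m) (hI : I.IsPure xorAndPred) (hT : Typed I) (hS : SimpleOverlap I) {r : ℕ}
    (hB : BoundaryExpanding r I) {B : BridgeData n m} (hW : B.WF I) (hr : (B.J₀ ∪ B.G₁ ∪ B.G₂).card ≤ r)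
    (hG₁ : Disjoint B.G₁ B.J₀) (hG₂ : Disjoint B.G₂ B.J₀) (hL : Lift I B)
    (hun : ∀ v ∈ privs I B.N, (∀ g ∈ B.G₁, I.vars g 2 ≠ v ∧ I.vars g 3 ≠ v) ∧ ∀ g ∈ B.G₂, I.vars g 2 ≠ v ∧ I.vars g 3 ≠ v)
    (hT3 : ¬ ∃ z, Solution I B B.J₀ z) {e₀ : Fin m} {j : Fin m} (hj : j ∈ B.D e₀) {z : Fin n → Bool} (hz : Solution I B (B.J₀.erase j) z) (hN : B.N = {e₀})
    (h1 : (sys I B).ρ e₀ 0 ≠ 0) (h2 : (sys I B).ρ' e₀ 0 ≠ 0) (h3 : (sys I B).ρ e₀ 0 ≠ (sys I B).ρ' e₀ 0) :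
    ∃ j₁ j₂ : Fin m, j₁ ≠ j₂ ∧ B.D e₀ = {j₁, j₂} ∧ Disjoint (andPair I j₁) (andPair I j₂) ∧
      ∃ σ ∈ andPair I j₁, ∃ τ ∈ andPair I j₂, ∃ g ∈ B.T₁ ∪ freeMon I B.N B.G₁ ∪ (B.T₂ ∪ freeMon I B.N B.G₂),
        σ ∈ andPair I g ∧ τ ∈ andPair I g := by
  classical
  have he₀ : e₀ ∈ B.N := by rw [hN]; exact mem_singleton_self _
  have he₀J : e₀ ∈ B.J₀ := hW.hN he₀
  have heG : e₀ ∉ B.G₁ ∪ B.G₂ := fun h => by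
    rcases mem_union.1 h with h | h
    · exact disjoint_left.1 hG₁ h he₀J
    · exact disjoint_left.1 hG₂ h he₀J
  have hJr : B.J₀.card ≤ r := (card_le_card (subset_union_left.trans subset_union_left)).trans hr
  have hconst := const_of_unread I B hun
  have hρ : ∀ x, (sys I B).ρ e₀ x = (sys I B).ρ e₀ 0 := fun x => (hconst e₀ x 0).1
  have hρ' : ∀ x, (sys I B).ρ' e₀ x = (sys I B).ρ' e₀ 0 := fun x => (hconst e₀ x 0).2
  have hp := hun _ (vars_mem_privs I he₀ (s := 2) (by decide))
  have hp' := hun _ (vars_mem_privs I he₀ (s := 3) (by decide))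
  have hG₁' : ∀ g ∈ B.G₁, I.vars g 2 ≠ I.vars e₀ 2 ∧ I.vars g 2 ≠ I.vars e₀ 3 ∧ I.vars g 3 ≠ I.vars e₀ 2 ∧ I.vars g 3 ≠ I.vars e₀ 3 :=
    fun g hg => ⟨(hp.1 g hg).1, (hp'.1 g hg).1, (hp.1 g hg).2, (hp'.1 g hg).2⟩
  have hG₂' : ∀ g ∈ B.G₂, I.vars g 2 ≠ I.vars e₀ 2 ∧ I.vars g 2 ≠ I.vars e₀ 3 ∧ I.vars g 3 ≠ I.vars e₀ 2 ∧ I.vars g 3 ≠ I.vars e₀ 3 :=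
    fun g hg => ⟨(hp.2 g hg).1, (hp'.2 g hg).1, (hp.2 g hg).2, (hp'.2 g hg).2⟩
  have hinf : (sys I B).Infeasible B.N := infeasible_of_not_solution I hI hT hW hL hT3
  obtain ⟨hfac, hncr, hncr', hne⟩ := corner_factorisation' I hI hT hS hB hW hJr hG₁.symm hG₂.symm hN h1 h2 h3 hρ hρ' hG₁' hG₂' hinf hT3 hj hz
  -- the factorisation, read for each factor
  have hFr : ∀ x, gam B e₀ + qform (B.D e₀) (fun j => I.vars j 2) (fun j => I.vars j 3) x =
      qDir I B ((sys I B).ρ' e₀ 0) x * qDir I B ((sys I B).ρ e₀ 0) x + 1 := fun x => by rw [← sys_u_eq]; exact hfac x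
  have hFr' : ∀ x, gam B e₀ + qform (B.D e₀) (fun j => I.vars j 2) (fun j => I.vars j 3) x =
      qDir I B ((sys I B).ρ e₀ 0) x * qDir I B ((sys I B).ρ' e₀ 0) x + 1 := fun x => by rw [mul_comm]; exact hFr x
  rcases dir_cases_of_factor I hI hS hB hW hr he₀ heG _ hncr hFr with hq | hunit
  · rcases dir_cases_of_factor I hI hS hB hW hr he₀ heG _ hncr' hFr' with hq' | hunit
    · exact absurd (fun x => (hq x).trans (hq' x).symm) hne
    · exact hunit
  · exact hunit

/-- **The (U2) corner has `#J₀ = 3`** — one-witness form of `PstarChordBridgeCornerUnit.card_eq_three_of_corner`. -/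
theorem card_eq_three_of_corner' (I : LocalMap 4 n m) (hI : I.IsPure xorAndPred) (hT : Typed I) (hS : SimpleOverlap I) {r : ℕ}
    (hB : BoundaryExpanding r I) {B : BridgeData n m} (hW : B.WF I) (hr : (B.J₀ ∪ B.G₁ ∪ B.G₂).card ≤ r)
    (hG₁ : Disjoint B.G₁ B.J₀) (hG₂ : Disjoint B.G₂ B.J₀) (hL : Lift I B)
    (hun : ∀ v ∈ privs I B.N, (∀ g ∈ B.G₁, I.vars g 2 ≠ v ∧ I.vars g 3 ≠ v) ∧ ∀ g ∈ B.G₂, I.vars g 2 ≠ v ∧ I.vars g 3 ≠ v)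
    (hT3 : ¬ ∃ z, Solution I B B.J₀ z) {e₀ : Fin m} (hN : B.N = {e₀})
    (hJ : B.J₀ = insert e₀ (B.D e₀))
    (h1 : (sys I B).ρ e₀ 0 ≠ 0) (h2 : (sys I B).ρ' e₀ 0 ≠ 0) (h3 : (sys I B).ρ e₀ 0 ≠ (sys I B).ρ' e₀ 0)
    {j : Fin m} (hj : j ∈ B.D e₀) {z : Fin n → Bool} (hz : Solution I B (B.J₀.erase j) z) : B.J₀.card = 3 := by
  classical
  have he₀ : e₀ ∈ B.N := by rw [hN]; exact mem_singleton_self _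
  have heD : e₀ ∉ B.D e₀ := fun h => (mem_sdiff.1 (hW.hD e₀ he₀ h)).2 he₀
  obtain ⟨j₁, j₂, hne, hD, -⟩ := corner_unit' I hI hT hS hB hW hr hG₁ hG₂ hL hun hT3 hj hz hN h1 h2 h3
  rw [hJ, card_insert_of_notMem heD, hD, card_pair hne]

end Summit.PneNP.PneNP.Theorems.PstarUnionCornerWitness
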